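import Summits.QuantumFields.BalabanUV.Beta.GAN24.CombBornLambdaContactPairLineage
import Summits.QuantumFields.BalabanUV.Beta.GAN24.CombBornLambdaContactBound
import Summits.QuantumFields.BalabanUV.Beta.GAN24.BornLambdaContactDrift

/-!
# `BalabanUV.Beta.GAN24.CombBornLambdaContactDrift` — binder row G-an2-4 ∕ (CONV-C), TRANSFER-III, the (III′) S-slot (b) of the END `CombChargeRowsClosed`: **THE BORN-Λ CONTACT PAIR
# `hPc′` OF road-P2 M.104 IS A THEOREM FROM `2 ≤ Lc` ALONE** (`d = 3`; every weight base at the pin `|cE| ≤ Lc^4`, every `cΛ`, every sym-table record `tabs.H = symHessFFAt ρ_t Lc`, all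
# in-block leg roots; then the centred leg roots `ctrOff ∕ ctr` = M.104's fourth hypothesis LITERALLY, `q = 1`) — the twin of MY g61 (E) END `BornLambdaContactDrift.exists_hPc_three`:
# MY PAIR PART 1 count `CombBornLambdaContactPairLineage.abs_weight_mul_comb_contactPair_le_three` with every letter DISCHARGED from the tree — (N1), road-P2's CT-4a
# `RespStepCauchy.exists_respStep_cauchy`, the OWNER's conjugated envelope `CombLegEnvelope.exists_legChain_psiLeg_envelope`, MY g89 gauge envelope `abs_combGauge_le`, the (E) coefficient
# letters, MY `CombBornLambdaContactCells` (record identities, transversality at the sym table), the OWNER's W54c bracket letter for the conjugated legs and — §1 here — the bracket PAIR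
# letter for the conjugated legs (W54c §3 `tsum_sum_combLegChain_mul_tentCoeff_eq`: the conjugation drops out of EVERY born-Λ bracket, so MY (E) `BornLambdaBracketPair` letter transfers)
# (G-an2-4 CRUX TEAM (2), leaf prover `b2b-balaban-gan24-formalise-leaf-01`, gen 90)

WHAT IS PROVED (`d = 3`, `2 ≤ Lc`; [folklore] bookkeeping over the named tree theorems):
* §1 `exists_bracket_bornLam_succ_pair_letter_comb_three` — MY (E) bracket-pair letter with `T ↦ T′`, same `(C, δ, θ)`, ∀ roots `r rr ∈ box`.
* §2 **`exists_comb_hPc_three`** (all roots ∕ records) and **`exists_comb_hPc_ctr`** (roots `ctrOff ∕ ctr`, record at any in-block root) — LITERALLY the binder `hPc` (with `q = 1`) of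
  road-P2 M.104 ∕ MY `CombSRowsOfThreeContactLetters` ∕ the OWNER's S54c `CombChargeRowsOfBornContactLetters`.
WHAT THIS DISCHARGES AND WHAT NOT: the born-Λ contact PAIR; with MY `CombBornLambdaContactBound` the born-Λ sector of (b) is OFF THE BILL; NOT the born-V letters `hCv ∕ hPcV`, hence NOT
`(hS, hSall)` and NOT the END by itself.

NOT IN PRINT; OUR PROOF ([folklore] bookkeeping BY NAME; 0 `def`, 0 cited fact, 0 `def … : Prop`, 0 sorry).  HONEST FRAMING (cell contract, verbatim): «discharging `BetaPertH` makes
Bałaban's UV stability UNCONDITIONAL — a real constructive-QFT result; it is NOT the continuum limit and NOT the Clay problem.»  HONEST DEPENDENCY (verbatim): «continuum YM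
on T⁴ ⇐ BetaPertH ∧ nine spine estimates (0/9 proved); BetaPertH ⇐ (D1) ∧ (D4) ∧ CAP+tail; G-an2-4 gates asym, D1 and NE2/3/4.»  NEVER «G-an2-4 closed» as (CONV-C); NOT D1, NOT
`BetaPertH`, NOT continuum, NOT Clay.  2026-08-28; no existing file touched.
-/

noncomputable section

open Finset
open scoped BigOperators
open Literature.MathematicalPhysics.QuantumFieldTheory
open Literature.MathematicalPhysics.QuantumFieldTheory.LatticeForm (quo)
open Literature.MathematicalPhysics.QuantumFieldTheory.Balaban1983to89
open Literature.MathematicalPhysics.QuantumFieldTheory.Balaban1983to89.Beta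
open B4ContourShift (supNorm supNorm_nonneg)
open B12Sec2to5 (l1 l1_nonneg)
open ExpKernelCalculus (MKer Zl Zl_nonneg)
open AffineAveraging (Form0 Form1 Site box toSite unitVec dz)
open AffineReproduction (contourSumAdj)
open KernelSpecInstance (wΦ)
open AveragingContours (blk)
open AveragingContoursRooted (ctr ctrOff ctrOff_mem_box)
open AveragingHessianKernels (ell)
open OneStepResolventKernel (Fib LocStencil KInv)
open InterLevelTransport (SLam)
open KernelWard (divV)
open KKTFluctuationKernel (delta1)
open BalabanCompositeJets (respStep)
open BalabanStepJetsSucc (E2 lamCoeffK)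
open Summit.QuantumFields.BalabanUV.Beta.AxialProjectorBlockMean (bmGaugeAt)
open Summit.QuantumFields.BalabanUV.Beta.HessKerDressedUnits (unitS)
open Summit.QuantumFields.BalabanUV.Beta.SymCorrectorKernel (psiKS)
open Summit.QuantumFields.BalabanUV.Beta.SymCorrectorFace (faceWtSum faceWtSum_nonneg)
open Summit.QuantumFields.BalabanUV.Beta.SymAveragingHessianCounts (symHessFFAt)
open Summit.QuantumFields.BalabanUV.Beta.SymmetrisedStepJets (SymTables)
open Summit.QuantumFields.BalabanUV.Beta.GAN24.CombesThomas (SupBound sfStep smStep KStepUnit)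
open Summit.QuantumFields.BalabanUV.Beta.GAN24.RespStepBmDecompExact (respStepBmSeq)
open Summit.QuantumFields.BalabanUV.Beta.GAN24.RespStepBmDecompPsi (Psi)
open Summit.QuantumFields.BalabanUV.Beta.GAN24.Push4 (legComp IsFF)
open Summit.QuantumFields.BalabanUV.Beta.GAN24.Push4Iter (legChain)
open Summit.QuantumFields.BalabanUV.Beta.GAN24.Push3 (push₃)
open Summit.QuantumFields.BalabanUV.Beta.GAN24.Push3LegTelescope (abs_le_of_env' summable_of_env')
open Summit.QuantumFields.BalabanUV.Beta.GAN24.CombBornSector (combFreshAt)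
open Summit.QuantumFields.BalabanUV.Beta.GAN24.CombLegChainGauge (PsiFace)
open Summit.QuantumFields.BalabanUV.Beta.GAN24.StencilSlotOfShapes (locStencil_mono')
open Summit.QuantumFields.BalabanUV.Beta.GAN24.ContactLambdaCellBound (exp_env_mono_rate)
open Summit.QuantumFields.BalabanUV.Beta.GAN24.RespStepDecay (exists_respStep_decay_and_grad)
open Summit.QuantumFields.BalabanUV.Beta.GAN24.RespStepCauchy (exists_respStep_cauchy)
open Summit.QuantumFields.BalabanUV.Beta.GAN24.UndressedResponseUnits (inv_cast_pow_pow)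
open Summit.QuantumFields.BalabanUV.Beta.GAN24.FibreStrip (unitDecayK_holds)
open Summit.QuantumFields.BalabanUV.Beta.GAN24.CombLegEnvelope (exists_legChain_psiLeg_envelope)
open Summit.QuantumFields.BalabanUV.Beta.GAN24.CombContactGaugeStaircase (abs_combGauge_le)
open Summit.QuantumFields.BalabanUV.Beta.GAN24.BornLambdaContactCells (abs_bornLamCoeff_succ_le_of_unitDecayK)
open Summit.QuantumFields.BalabanUV.Beta.GAN24.CombBornLambdaContactCells (unitS_combFreshAt_lam_succ_eq_SLam divV_combBornLam_succ_eq_zero)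
open Summit.QuantumFields.BalabanUV.Beta.GAN24.BornLambdaBracketLetter (bornCoeff_succ_eq_tent)
open Summit.QuantumFields.BalabanUV.Beta.GAN24.BornLambdaBracketPair (exists_bracket_bornLam_succ_pair_letter_three)
open Summit.QuantumFields.BalabanUV.Beta.GAN24.CombBornLambdaGaugeBlind (tsum_sum_combLegChain_mul_tentCoeff_eq exists_bracket_bornLam_succ_letter_comb_three)
open Summit.QuantumFields.BalabanUV.Beta.GAN24.BornLambdaContactBound (bracket_letter_mono)
open Summit.QuantumFields.BalabanUV.Beta.GAN24.BornLambdaContactDrift (final_le bracketPair_letter_mono)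
open Summit.QuantumFields.BalabanUV.Beta.GAN24.CombBornLambdaContactPairLineage (abs_weight_mul_comb_contactPair_le_three)

namespace Summit.QuantumFields.BalabanUV.Beta.GAN24.CombBornLambdaContactDrift

variable {Lc : ℕ} [NeZero Lc]

/-! ## §1 The bracket PAIR letter for the conjugated legs -/

/-- NOT IN PRINT; OUR BOOKKEEPING.  **THE BORN-Λ BRACKET PAIR LETTER IS BLIND TO THE CONJUGATION** (`d = 3`, `2 ≤ Lc`; MY (E) `exists_bracket_bornLam_succ_pair_letter_three`'s `(C, δ, θ)`,
∀ roots `r rr ∈ box`): the difference of the brackets of the conjugated chains `T′ (j+2) m` and `T′ (j+1) m` against the member-`(j+2)` ∕ `(j+1)` born-Λ coefficient families is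
`≤ |cΛ|·C·θ^{j+1+m}·((Lc^m)^7)⁻¹·e^{−δ‖quo (Lc^m) y − u′‖∞}` — each bracket equals the dressed chain's (W54c §3 + `bornCoeff_succ_eq_tent`). -/
theorem exists_bracket_bornLam_succ_pair_letter_comb_three (hLc : 2 ≤ Lc) :
    ∃ C δ θ : ℝ, 0 ≤ C ∧ 0 < δ ∧ 0 ≤ θ ∧ θ < 1 ∧ ∀ (r : Fin (3 + 1) → ℕ), r ∈ box (3 + 1) Lc → ∀ (rr : Fin (3 + 1) → ℕ), rr ∈ box (3 + 1) Lc → ∀ (cΛ : ℝ) (j m : ℕ),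
      ∀ (κ' : Fin (3 + 1)) (u' : Site (3 + 1)) (μ : Fin (3 + 1)) (y : Site (3 + 1)),
        |(∑' u, ∑ κ, legChain (fun j => legComp (fun α x κ u => psiKS r Lc u x (Sum.inl κ) (Sum.inl α)) (respStepBmSeq (d := 3) (toSite rr) Lc j)) (j + 1 + 1) m κ' u' κ u *
            ((cΛ * (Lc : ℝ) ^ (2 * (3 + 1))) *
              lamCoeffK (KStepUnit (d := 3) Lc (j + 1 + 1)) ((smStep 3 Lc (j + 1)) ^ 2 • E2 3 Lc (j + 1 + 1)) Lc μ y κ u))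
          - ∑' u, ∑ κ, legChain (fun j => legComp (fun α x κ u => psiKS r Lc u x (Sum.inl κ) (Sum.inl α)) (respStepBmSeq (d := 3) (toSite rr) Lc j)) (j + 1) m κ' u' κ u *
            ((cΛ * (Lc : ℝ) ^ (2 * (3 + 1))) *
              lamCoeffK (KStepUnit (d := 3) Lc (j + 1)) ((smStep 3 Lc j) ^ 2 • E2 3 Lc (j + 1)) Lc μ y κ u)|
          ≤ |cΛ| * C * θ ^ (j + 1 + m) * ((((Lc : ℝ) ^ m) ^ (2 * 3 + 1))⁻¹) * Real.exp (-(δ * supNorm (quo (Lc ^ m) y - u'))) := by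
  obtain ⟨C, δ, θ, hC, hδ, hθ0, hθ1, h⟩ := exists_bracket_bornLam_succ_pair_letter_three (Lc := Lc) hLc
  refine ⟨C, δ, θ, hC, hδ, hθ0, hθ1, fun r hr rr hrr cΛ j m κ' u' μ y => ?_⟩
  have key : ∀ jj : ℕ,
      (∑' u, ∑ κ, legChain (fun j => legComp (fun α x κ u => psiKS r Lc u x (Sum.inl κ) (Sum.inl α)) (respStepBmSeq (d := 3) (toSite rr) Lc j)) (jj + 1) m κ' u' κ u *
          ((cΛ * (Lc : ℝ) ^ (2 * (3 + 1))) * lamCoeffK (KStepUnit (d := 3) Lc (jj + 1)) ((smStep 3 Lc jj) ^ 2 • E2 3 Lc (jj + 1)) Lc μ y κ u))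
        = ∑' u, ∑ κ, legChain (respStepBmSeq (d := 3) (toSite rr) Lc) (jj + 1) m κ' u' κ u *
          ((cΛ * (Lc : ℝ) ^ (2 * (3 + 1))) * lamCoeffK (KStepUnit (d := 3) Lc (jj + 1)) ((smStep 3 Lc jj) ^ 2 • E2 3 Lc (jj + 1)) Lc μ y κ u) := by
    intro jj
    have e : ∀ (T : Fin (3 + 1) → Site (3 + 1) → Fin (3 + 1) → Site (3 + 1) → ℝ),
        (fun u => ∑ κ, T κ' u' κ u * ((cΛ * (Lc : ℝ) ^ (2 * (3 + 1))) * lamCoeffK (KStepUnit (d := 3) Lc (jj + 1)) ((smStep 3 Lc jj) ^ 2 • E2 3 Lc (jj + 1)) Lc μ y κ u))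
          = fun u => ∑ κ, T κ' u' κ u * ((-cΛ) * ((((Lc : ℝ) ^ (jj + 1)) ^ (2 * (3 + 1))) *
              contourSumAdj Lc (fun κ'' q => wΦ (N := Lc ^ (jj + 1 + 1)) (d := 3) κ'' μ (q - y)) κ u)) := by
      intro T; funext u
      exact Finset.sum_congr rfl fun κ _ => by rw [bornCoeff_succ_eq_tent]
    rw [show (∑' u, ∑ κ, legChain (fun j => legComp (fun α x κ u => psiKS r Lc u x (Sum.inl κ) (Sum.inl α)) (respStepBmSeq (d := 3) (toSite rr) Lc j)) (jj + 1) m κ' u' κ u *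
          ((cΛ * (Lc : ℝ) ^ (2 * (3 + 1))) * lamCoeffK (KStepUnit (d := 3) Lc (jj + 1)) ((smStep 3 Lc jj) ^ 2 • E2 3 Lc (jj + 1)) Lc μ y κ u))
        = ∑' u, (fun u => ∑ κ, legChain (fun j => legComp (fun α x κ u => psiKS r Lc u x (Sum.inl κ) (Sum.inl α)) (respStepBmSeq (d := 3) (toSite rr) Lc j)) (jj + 1) m κ' u' κ u *
          ((cΛ * (Lc : ℝ) ^ (2 * (3 + 1))) * lamCoeffK (KStepUnit (d := 3) Lc (jj + 1)) ((smStep 3 Lc jj) ^ 2 • E2 3 Lc (jj + 1)) Lc μ y κ u)) u from rfl,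
      e, tsum_sum_combLegChain_mul_tentCoeff_eq (d := 3) hr hrr (jj + 1) m κ' u' (-cΛ) (((Lc : ℝ) ^ (jj + 1)) ^ (2 * (3 + 1))) μ y,
      show (∑' u, ∑ κ, legChain (respStepBmSeq (d := 3) (toSite rr) Lc) (jj + 1) m κ' u' κ u *
          ((cΛ * (Lc : ℝ) ^ (2 * (3 + 1))) * lamCoeffK (KStepUnit (d := 3) Lc (jj + 1)) ((smStep 3 Lc jj) ^ 2 • E2 3 Lc (jj + 1)) Lc μ y κ u))
        = ∑' u, (fun u => ∑ κ, legChain (respStepBmSeq (d := 3) (toSite rr) Lc) (jj + 1) m κ' u' κ u *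
          ((cΛ * (Lc : ℝ) ^ (2 * (3 + 1))) * lamCoeffK (KStepUnit (d := 3) Lc (jj + 1)) ((smStep 3 Lc jj) ^ 2 • E2 3 Lc (jj + 1)) Lc μ y κ u)) u from rfl, e]
  rw [key (j + 1), key j]
  exact h rr hrr cΛ j m κ' u' μ y

/-! ## §2 The END: the (III′) born-Λ contact PAIR `hPc′` -/

set_option maxHeartbeats 800000 in
/-- NOT IN PRINT; OUR PROOF (`d = 3`, `2 ≤ Lc`).  **THE (III′) BORN-Λ CONTACT PAIR, ALL ROOTS**: for every weight base at the pin `|cE| ≤ Lc^4` and every `cΛ` there are `CPc ≥ 0` and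
`0 ≤ Θc < 1` such that for EVERY sym-table record (`tabs.H` ff-valued, `= symHessFFAt (toSite rt) Lc`, `rt ∈ box`), EVERY corrector root `r ∈ box`, EVERY dressing root `rl ∈ box` and all
`1 ≤ i < k`, the weighted contact entries of the consecutive conjugated Λ lineages `(i+1, k+1)` and `(i, k)` differ by at most `CPc·(k−i)^1·Θc^k` in `SupBound`.  MY (E) END's proof
with the conjugated letters: (N1), CT-4a (one rate by `min`), the OWNER's conjugated envelope, MY g89 gauge envelope (face letter `F := Σ_{r′∈box} faceWtSum r′ Lc`), `unitDecayK_holds` +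
the (E) coefficient letter + MY sym transversality for both members, W54c's bracket letter (both brackets) and §1 (their difference); `Θc = max(Lc⁻¹, θ)`. -/
theorem exists_comb_hPc_three (hLc : 2 ≤ Lc) {cE : ℝ} (hcE : |cE| ≤ (Lc : ℝ) ^ 4) (cΛ : ℝ) :
    ∃ CPc Θc : ℝ, 0 ≤ CPc ∧ 0 ≤ Θc ∧ Θc < 1 ∧ ∀ (tabs : SymTables 3 Lc), (∀ μ y, IsFF (tabs.H μ y)) →
      ∀ (rt : Fin (3 + 1) → ℕ), rt ∈ box (3 + 1) Lc → tabs.H = symHessFFAt (toSite rt) Lc →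
      ∀ (r : Fin (3 + 1) → ℕ), r ∈ box (3 + 1) Lc → ∀ (rl : Fin (3 + 1) → ℕ), rl ∈ box (3 + 1) Lc → ∀ k i : ℕ, 1 ≤ i → i < k → ∀ κ u,
      SupBound
        (((fun κ' u' => (cE * (Lc : ℝ) ^ (2 * (3 + 1))) ^ (k - i) •
            (push₃ (legChain (fun j => legComp (fun α x κ u => psiKS r Lc u x (Sum.inl κ) (Sum.inl α)) (respStepBmSeq (d := 3) (toSite rl) Lc j)) (i + 1) (k - 1 - i))
                (legChain (fun j => legComp (fun α x κ u => psiKS r Lc u x (Sum.inl κ) (Sum.inl α)) (respStepBmSeq (d := 3) (toSite rl) Lc j)) (i + 1) (k - 1 - i))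
                (legChain (fun j => legComp (fun α x κ u => psiKS r Lc u x (Sum.inl κ) (Sum.inl α)) (respStepBmSeq (d := 3) (toSite rl) Lc j)) (i + 1) (k - 1 - i))
                (unitS (sfStep Lc (i + 1)) (smStep 3 Lc (i + 1)) (combFreshAt tabs 0 cΛ (i + 1))) κ' u'
              - push₃ (respStep (d := 3) (Lc ^ (i + 1)) (Lc ^ (k + 1))) (respStep (d := 3) (Lc ^ (i + 1)) (Lc ^ (k + 1)))
                (respStep (d := 3) (Lc ^ (i + 1)) (Lc ^ (k + 1)))
                (unitS (sfStep Lc (i + 1)) (smStep 3 Lc (i + 1)) (combFreshAt tabs 0 cΛ (i + 1))) κ' u'))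
          - fun κ' u' => (cE * (Lc : ℝ) ^ (2 * (3 + 1))) ^ (k - i) •
            (push₃ (legChain (fun j => legComp (fun α x κ u => psiKS r Lc u x (Sum.inl κ) (Sum.inl α)) (respStepBmSeq (d := 3) (toSite rl) Lc j)) i (k - 1 - i))
                (legChain (fun j => legComp (fun α x κ u => psiKS r Lc u x (Sum.inl κ) (Sum.inl α)) (respStepBmSeq (d := 3) (toSite rl) Lc j)) i (k - 1 - i))
                (legChain (fun j => legComp (fun α x κ u => psiKS r Lc u x (Sum.inl κ) (Sum.inl α)) (respStepBmSeq (d := 3) (toSite rl) Lc j)) i (k - 1 - i))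
                (unitS (sfStep Lc i) (smStep 3 Lc i) (combFreshAt tabs 0 cΛ i)) κ' u'
              - push₃ (respStep (d := 3) (Lc ^ i) (Lc ^ k)) (respStep (d := 3) (Lc ^ i) (Lc ^ k)) (respStep (d := 3) (Lc ^ i) (Lc ^ k))
                (unitS (sfStep Lc i) (smStep 3 Lc i) (combFreshAt tabs 0 cΛ i)) κ' u')) κ u)
        (CPc * ((((k - i : ℕ) : ℝ)) ^ 1 * Θc ^ k)) := by
  have hLc1 : 1 ≤ Lc := le_trans (by norm_num) hLc
  have hL : (0 : ℝ) < (Lc : ℝ) := Nat.cast_pos.2 (Nat.pos_of_ne_zero (NeZero.ne Lc))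
  -- the tree letters, constants outside every ∀
  obtain ⟨κ₀, C₁, -, hκ₀, hC₁, -, hN1raw, -⟩ := exists_respStep_decay_and_grad (Lc := Lc)
  obtain ⟨cC, θ, κc, hcC, hθ0, hθ1, hκc, hCauRaw⟩ := exists_respStep_cauchy (Lc := Lc) hLc
  set κ₁ : ℝ := min κ₀ κc with hκ₁def
  have hκ₁ : 0 < κ₁ := lt_min hκ₀ hκc
  have hN1 : ∀ (m k : ℕ) (μ : Fin (3 + 1)) (z : Site (3 + 1)) (l'' : Fin (3 + 1)) (w' : Site (3 + 1)),
      |respStep (d := 3) (Lc ^ m) (Lc ^ (m + k + 1)) μ z l'' w'| ≤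
        C₁ * ((Lc : ℝ) ^ (5 * (k + 1)))⁻¹ * Real.exp (-(κ₁ * supNorm (quo (Lc ^ (k + 1)) w' - z))) := by
    intro m k μ z l'' w'
    have h := hN1raw m k μ z l'' w'
    rw [inv_cast_pow_pow] at h
    exact h.trans (mul_le_mul_of_nonneg_left (exp_env_mono_rate (min_le_left _ _) (supNorm_nonneg _)) (by positivity))
  have hCau : ∀ (s k : ℕ) (μ : Fin (3 + 1)) (z : Site (3 + 1)) (l : Fin (3 + 1)) (w : Site (3 + 1)),
      |respStep (d := 3) (Lc ^ (s + 1)) (Lc ^ (s + k + 2)) μ z l w - respStep (d := 3) (Lc ^ s) (Lc ^ (s + k + 1)) μ z l w|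
        ≤ cC * θ ^ (s + k) * ((((Lc ^ (k + 1) : ℕ) : ℝ)) ^ (3 + 2))⁻¹ * Real.exp (-(κ₁ * supNorm (quo (Lc ^ (k + 1)) w - z))) := by
    intro s k μ z l w
    exact (hCauRaw s k μ z l w).trans (mul_le_mul_of_nonneg_left (exp_env_mono_rate (min_le_right _ _) (supNorm_nonneg _)) (by positivity))
  obtain ⟨κE, KE, hκE, -, hEnv⟩ := exists_legChain_psiLeg_envelope (Lc := Lc) hLc
  obtain ⟨Cs, δs, hCs, hδs, hbs⟩ := exists_bracket_bornLam_succ_letter_comb_three (Lc := Lc) hLc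
  obtain ⟨CP, δP, θP, hCP, hδP, hθP0, hθP1, hbP⟩ := exists_bracket_bornLam_succ_pair_letter_comb_three (Lc := Lc) hLc
  obtain ⟨κK, hκK, Cst, hK⟩ := unitDecayK_holds (Lc := Lc)
  -- one bracket rate, one geometric rate
  set δK : ℝ := min δs δP with hδKdef
  have hδK : 0 < δK := lt_min hδs hδP
  set ϑ : ℝ := max θ θP with hϑdef
  have hϑ0 : 0 ≤ ϑ := hθ0.trans (le_max_left _ _)
  have hϑ1 : ϑ < 1 := max_lt hθ1 hθP1
  have hCauϑ : ∀ (s k : ℕ) (μ : Fin (3 + 1)) (z : Site (3 + 1)) (l : Fin (3 + 1)) (w : Site (3 + 1)),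
      |respStep (d := 3) (Lc ^ (s + 1)) (Lc ^ (s + k + 2)) μ z l w - respStep (d := 3) (Lc ^ s) (Lc ^ (s + k + 1)) μ z l w|
        ≤ cC * ϑ ^ (s + k) * ((((Lc ^ (k + 1) : ℕ) : ℝ)) ^ (3 + 2))⁻¹ * Real.exp (-(κ₁ * supNorm (quo (Lc ^ (k + 1)) w - z))) := by
    intro s k μ z l w
    refine (hCau s k μ z l w).trans ?_
    have hp : θ ^ (s + k) ≤ ϑ ^ (s + k) := pow_le_pow_left₀ hθ0 (le_max_left _ _) _
    have h0 : 0 ≤ ((((Lc ^ (k + 1) : ℕ) : ℝ)) ^ (3 + 2))⁻¹ * Real.exp (-(κ₁ * supNorm (quo (Lc ^ (k + 1)) w - z))) := by positivity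
    calc cC * θ ^ (s + k) * ((((Lc ^ (k + 1) : ℕ) : ℝ)) ^ (3 + 2))⁻¹ * Real.exp (-(κ₁ * supNorm (quo (Lc ^ (k + 1)) w - z)))
        = (cC * θ ^ (s + k)) * (((((Lc ^ (k + 1) : ℕ) : ℝ)) ^ (3 + 2))⁻¹ * Real.exp (-(κ₁ * supNorm (quo (Lc ^ (k + 1)) w - z)))) := by ring
      _ ≤ (cC * ϑ ^ (s + k)) * (((((Lc ^ (k + 1) : ℕ) : ℝ)) ^ (3 + 2))⁻¹ * Real.exp (-(κ₁ * supNorm (quo (Lc ^ (k + 1)) w - z)))) :=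
          mul_le_mul_of_nonneg_right (mul_le_mul_of_nonneg_left hp hcC) h0
      _ = _ := by ring
  have hκ : 0 < min δK κ₁ := lt_min hδK hκ₁
  -- the coefficient letter (uniform in the member)
  have hrate : 0 < κK / ((3 + 1) * (Lc : ℝ)) := by positivity
  have hrate2 : 0 < κK / ((3 + 1) * (Lc : ℝ)) / 2 := by positivity
  have hCc : 0 ≤ |cΛ * (Lc : ℝ) ^ (2 * (3 + 1))| * ((Fintype.card (Fib 3) : ℝ) * (Cst * Real.exp (2 * κK) * (Cst * Real.exp (2 * κK)))
      * Zl (3 + 1) (κK / ((3 + 1) * (Lc : ℝ)) - κK / ((3 + 1) * (Lc : ℝ)) / 2)) := by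
    have hz : 0 ≤ Zl (3 + 1) (κK / ((3 + 1) * (Lc : ℝ)) - κK / ((3 + 1) * (Lc : ℝ)) / 2) := Zl_nonneg (by linarith)
    have hsq : 0 ≤ Cst * Real.exp (2 * κK) * (Cst * Real.exp (2 * κK)) := mul_self_nonneg _
    positivity
  have hTb : 0 ≤ |cΛ| * Cs := mul_nonneg (abs_nonneg _) hCs
  have hTΔ : 0 ≤ |cΛ| * CP := mul_nonneg (abs_nonneg _) hCP
  -- the root-free face letter and the gauge letter `A`
  set F : ℝ := ∑ r' ∈ box (3 + 1) Lc, faceWtSum r' Lc with hFdef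
  have hFr : ∀ r ∈ box (3 + 1) Lc, faceWtSum r Lc ≤ F := fun r hr =>
    Finset.single_le_sum (f := fun r' => faceWtSum r' Lc) (fun r' _ => faceWtSum_nonneg r' Lc) hr
  have hF0 : 0 ≤ F := Finset.sum_nonneg fun r' _ => faceWtSum_nonneg r' Lc
  set A : ℝ := (1 + (Lc : ℝ)) * (8 * (Lc : ℝ) + F * (1 + 8 * (Lc : ℝ) * (Real.exp κ₁ + 1))) with hAdef
  have hA0 : 0 ≤ A := by positivity
  -- the constants
  set Θc : ℝ := max (Lc : ℝ)⁻¹ ϑ with hΘcdef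
  have hΘc0 : 0 ≤ Θc := hϑ0.trans (le_max_right _ _)
  have hΘc1 : Θc < 1 := by
    refine max_lt ?_ hϑ1
    have h2 : (2 : ℝ) ≤ Lc := by exact_mod_cast hLc
    rw [inv_lt_one_iff₀]; right; linarith
  have hZ : 0 ≤ Zl (3 + 1) (min δK κ₁ / (4 * ((3 : ℝ) + 1))) := Zl_nonneg (by positivity)
  refine ⟨(Lc : ℝ) ^ 3 * ((2 * ((((3 + 1).factorial : ℕ) : ℝ) * (Lc : ℝ) ^ (3 + 1)))⁻¹ * ((((3 : ℝ) + 1) * (Real.exp (2 * ((3 : ℝ) + 1) * min δK κ₁) ^ 2 *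
              (((2 * Lc : ℕ) : ℝ) ^ (3 + 1) * (((3 + 1 : ℕ) : ℝ) * ((((3 + 1).factorial : ℕ) : ℝ) * ((Lc : ℝ) ^ (3 + 1) * (ell (3 + 1) Lc : ℝ))))))))
            * (C₁ * ((|cΛ| * CP) * C₁ + 2 * (|cΛ| * Cs) * cC)) * (8 * A + 8 * A ^ 2 + 4 * A * Lc + 12 * A ^ 2 * Lc) * Zl (3 + 1) (min δK κ₁ / (4 * ((3 : ℝ) + 1)))),
    Θc, by positivity, hΘc0, hΘc1, fun tabs hHff rt hrt hH r hr rl hrl k i hi hik κ₂ u₂ x z a b => ?_⟩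
  obtain ⟨n, rfl⟩ : ∃ n, k = i + n + 1 := ⟨k - i - 1, by omega⟩
  obtain ⟨j, rfl⟩ : ∃ j, i = j + 1 := ⟨i - 1, by omega⟩
  have e1 : j + 1 + n + 1 - 1 - (j + 1) = n := by omega
  have e2 : j + 1 + n + 1 - (j + 1) = n + 1 := by omega
  have e3 : j + 1 + n + 1 + 1 = j + 1 + 1 + n + 1 := by omega
  -- the two members' letters with explicit constants
  have hE : ∀ m μ z' l u, |legChain (fun j => legComp (fun α x κ u => psiKS r Lc u x (Sum.inl κ) (Sum.inl α)) (respStepBmSeq (d := 3) (toSite rl) Lc j)) m n μ z' l u|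
      ≤ (KE * ((n : ℝ) + 1) * ((Lc : ℝ) ^ (4 * (n + 1)))⁻¹) * Real.exp (-(κE * supNorm (quo (Lc ^ (n + 1)) u - z'))) :=
    fun m μ z' l u => hEnv r hr rl hrl m n μ z' l u
  have hlam : ∀ m μ z' u, |(Psi (toSite rl) Lc m n (delta1 μ z') + PsiFace r (toSite rl) Lc m n (delta1 μ z')
      - bmGaugeAt (toSite rl) (respStep (d := 3) (Lc ^ m) (Lc ^ (m + n + 1)) μ z') Lc) u|
        ≤ (2 * (8 * (Lc : ℝ) * C₁ * ((Lc : ℝ) ^ (5 * (n + 1)))⁻¹ + F * ((1 + 8 * (Lc : ℝ) * (Real.exp κ₁ + 1)) * C₁ * ((Lc : ℝ) ^ (5 * (n + 1)))⁻¹)) *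
          (Lc : ℝ) ^ (n + 1)) := by
    intro m μ z' u
    have h := abs_combGauge_le hκ₁.le hC₁ hN1 hr hrl (hFr r hr) hLc m n μ z' u
    rw [Pi.sub_apply, Pi.add_apply]
    refine h.trans ?_
    have hpre : 0 ≤ 2 * (8 * (Lc : ℝ) * C₁ * ((Lc : ℝ) ^ (5 * (n + 1)))⁻¹ + F * ((1 + 8 * (Lc : ℝ) * (Real.exp κ₁ + 1)) * C₁ * ((Lc : ℝ) ^ (5 * (n + 1)))⁻¹)) *
        (Lc : ℝ) ^ (n + 1) := by positivity
    have hexp : Real.exp (-(κ₁ * supNorm (quo (Lc ^ (n + 1)) u - z'))) ≤ 1 :=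
      Real.exp_le_one_iff.2 (neg_nonpos.2 (mul_nonneg hκ₁.le (supNorm_nonneg _)))
    calc _ ≤ (2 * (8 * (Lc : ℝ) * C₁ * ((Lc : ℝ) ^ (5 * (n + 1)))⁻¹ + F * ((1 + 8 * (Lc : ℝ) * (Real.exp κ₁ + 1)) * C₁ * ((Lc : ℝ) ^ (5 * (n + 1)))⁻¹)) *
          (Lc : ℝ) ^ (n + 1)) * 1 := mul_le_mul_of_nonneg_left hexp hpre
      _ = _ := mul_one _
  have hqi : 0 ≤ ((((Lc : ℝ) ^ n) ^ (2 * 3 + 1))⁻¹) := by positivity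
  have hϑp : 0 ≤ ϑ ^ (j + 1 + n) := pow_nonneg hϑ0 _
  have hbr' : ∀ (κ' : Fin (3 + 1)) (u' : Site (3 + 1)) μ y,
      |∑' u, ∑ l, legChain (fun j => legComp (fun α x κ u => psiKS r Lc u x (Sum.inl κ) (Sum.inl α)) (respStepBmSeq (d := 3) (toSite rl) Lc j)) (j + 1 + 1) n κ' u' l u *
          ((cΛ * (Lc : ℝ) ^ (2 * (3 + 1))) * lamCoeffK (KStepUnit (d := 3) Lc (j + 1 + 1)) ((smStep 3 Lc (j + 1)) ^ 2 • E2 3 Lc (j + 1 + 1)) Lc μ y l u)|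
        ≤ |cΛ| * Cs * ((((Lc : ℝ) ^ n) ^ (2 * 3 + 1))⁻¹) * Real.exp (-(δK * supNorm (quo (Lc ^ n) y - u'))) := by
    intro κ' u' μ y
    have h := hbs r hr rl hrl cΛ (j + 1) (j + 1 + 1 + n + 1) κ' u' μ y
    rw [show j + 1 + 1 + n + 1 - 1 - (j + 1 + 1) = n by omega] at h
    exact bracket_letter_mono le_rfl (min_le_left _ _) hqi (supNorm_nonneg _) h
  have hbr : ∀ (κ' : Fin (3 + 1)) (u' : Site (3 + 1)) μ y,
      |∑' u, ∑ l, legChain (fun j => legComp (fun α x κ u => psiKS r Lc u x (Sum.inl κ) (Sum.inl α)) (respStepBmSeq (d := 3) (toSite rl) Lc j)) (j + 1) n κ' u' l u *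
          ((cΛ * (Lc : ℝ) ^ (2 * (3 + 1))) * lamCoeffK (KStepUnit (d := 3) Lc (j + 1)) ((smStep 3 Lc j) ^ 2 • E2 3 Lc (j + 1)) Lc μ y l u)|
        ≤ |cΛ| * Cs * ((((Lc : ℝ) ^ n) ^ (2 * 3 + 1))⁻¹) * Real.exp (-(δK * supNorm (quo (Lc ^ n) y - u'))) := by
    intro κ' u' μ y
    have h := hbs r hr rl hrl cΛ j (j + 1 + n + 1) κ' u' μ y
    rw [show j + 1 + n + 1 - 1 - (j + 1) = n by omega] at h
    exact bracket_letter_mono le_rfl (min_le_left _ _) hqi (supNorm_nonneg _) h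
  have hbrΔ : ∀ (κ' : Fin (3 + 1)) (u' : Site (3 + 1)) μ y,
      |(∑' u, ∑ l, legChain (fun j => legComp (fun α x κ u => psiKS r Lc u x (Sum.inl κ) (Sum.inl α)) (respStepBmSeq (d := 3) (toSite rl) Lc j)) (j + 1 + 1) n κ' u' l u *
          ((cΛ * (Lc : ℝ) ^ (2 * (3 + 1))) * lamCoeffK (KStepUnit (d := 3) Lc (j + 1 + 1)) ((smStep 3 Lc (j + 1)) ^ 2 • E2 3 Lc (j + 1 + 1)) Lc μ y l u))
        - ∑' u, ∑ l, legChain (fun j => legComp (fun α x κ u => psiKS r Lc u x (Sum.inl κ) (Sum.inl α)) (respStepBmSeq (d := 3) (toSite rl) Lc j)) (j + 1) n κ' u' l u *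
          ((cΛ * (Lc : ℝ) ^ (2 * (3 + 1))) * lamCoeffK (KStepUnit (d := 3) Lc (j + 1)) ((smStep 3 Lc j) ^ 2 • E2 3 Lc (j + 1)) Lc μ y l u)|
        ≤ |cΛ| * CP * ϑ ^ (j + 1 + n) * ((((Lc : ℝ) ^ n) ^ (2 * 3 + 1))⁻¹) * Real.exp (-(δK * supNorm (quo (Lc ^ n) y - u'))) := by
    intro κ' u' μ y
    have h := hbP r hr rl hrl cΛ j n κ' u' μ y
    have hp : θP ^ (j + 1 + n) ≤ ϑ ^ (j + 1 + n) := pow_le_pow_left₀ hθP0 (le_max_right _ _) _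
    have h' : |(∑' u, ∑ l, legChain (fun j => legComp (fun α x κ u => psiKS r Lc u x (Sum.inl κ) (Sum.inl α)) (respStepBmSeq (d := 3) (toSite rl) Lc j)) (j + 1 + 1) n κ' u' l u *
          ((cΛ * (Lc : ℝ) ^ (2 * (3 + 1))) * lamCoeffK (KStepUnit (d := 3) Lc (j + 1 + 1)) ((smStep 3 Lc (j + 1)) ^ 2 • E2 3 Lc (j + 1 + 1)) Lc μ y l u))
        - ∑' u, ∑ l, legChain (fun j => legComp (fun α x κ u => psiKS r Lc u x (Sum.inl κ) (Sum.inl α)) (respStepBmSeq (d := 3) (toSite rl) Lc j)) (j + 1) n κ' u' l u *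
          ((cΛ * (Lc : ℝ) ^ (2 * (3 + 1))) * lamCoeffK (KStepUnit (d := 3) Lc (j + 1)) ((smStep 3 Lc j) ^ 2 • E2 3 Lc (j + 1)) Lc μ y l u)|
        ≤ |cΛ| * CP * ϑ ^ (j + 1 + n) * ((((Lc : ℝ) ^ n) ^ (2 * 3 + 1))⁻¹) * Real.exp (-(δP * supNorm (quo (Lc ^ n) y - u'))) := by
      refine h.trans ?_
      have h0 : 0 ≤ ((((Lc : ℝ) ^ n) ^ (2 * 3 + 1))⁻¹) * Real.exp (-(δP * supNorm (quo (Lc ^ n) y - u'))) := by positivity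
      calc |cΛ| * CP * θP ^ (j + 1 + n) * ((((Lc : ℝ) ^ n) ^ (2 * 3 + 1))⁻¹) * Real.exp (-(δP * supNorm (quo (Lc ^ n) y - u')))
          = (|cΛ| * CP * θP ^ (j + 1 + n)) * (((((Lc : ℝ) ^ n) ^ (2 * 3 + 1))⁻¹) * Real.exp (-(δP * supNorm (quo (Lc ^ n) y - u')))) := by ring
        _ ≤ (|cΛ| * CP * ϑ ^ (j + 1 + n)) * (((((Lc : ℝ) ^ n) ^ (2 * 3 + 1))⁻¹) * Real.exp (-(δP * supNorm (quo (Lc ^ n) y - u')))) :=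
            mul_le_mul_of_nonneg_right (mul_le_mul_of_nonneg_left hp hTΔ) h0
        _ = _ := by ring
    exact bracketPair_letter_mono le_rfl (min_le_right _ _) hϑp hqi (supNorm_nonneg _) h'
  -- `(Lc⁻¹)^{n+1}·ϑ^{j+1+n}·EX ≤ Θc^{j+1+n+1}`
  have hEX : Real.exp (-(min δK κ₁ / 12) * (supNorm (x - u₂) + supNorm (z - u₂))) ≤ 1 :=
    Real.exp_le_one_iff.2 (mul_nonpos_of_nonpos_of_nonneg (neg_nonpos.2 (le_of_lt (by positivity)))
      (add_nonneg (supNorm_nonneg _) (supNorm_nonneg _)))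
  have hpow : ((Lc : ℝ)⁻¹) ^ (n + 1) * ϑ ^ (j + 1 + n) ≤ Θc ^ (j + 1 + n + 1) := by
    have h1 : ((Lc : ℝ)⁻¹) ^ (n + 1) ≤ Θc ^ (n + 1) := pow_le_pow_left₀ (inv_pos.2 hL).le (le_max_left _ _) _
    have h2 : ϑ ^ (j + 1 + n) ≤ Θc ^ (j + 1 + n) := pow_le_pow_left₀ hϑ0 (le_max_right _ _) _
    have h3 : Θc ^ (n + 1) * Θc ^ (j + 1 + n) ≤ Θc ^ (j + 1 + n + 1) := by
      rw [← pow_add]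
      exact pow_le_pow_of_le_one hΘc0 hΘc1.le (by omega)
    exact (mul_le_mul h1 h2 hϑp (pow_nonneg hΘc0 _)).trans h3
  have hBIG : 0 ≤ (Lc : ℝ) ^ 3 * ((2 * ((((3 + 1).factorial : ℕ) : ℝ) * (Lc : ℝ) ^ (3 + 1)))⁻¹ * ((((3 : ℝ) + 1) * (Real.exp (2 * ((3 : ℝ) + 1) * min δK κ₁) ^ 2 *
              (((2 * Lc : ℕ) : ℝ) ^ (3 + 1) * (((3 + 1 : ℕ) : ℝ) * ((((3 + 1).factorial : ℕ) : ℝ) * ((Lc : ℝ) ^ (3 + 1) * (ell (3 + 1) Lc : ℝ))))))))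
            * (C₁ * ((|cΛ| * CP) * C₁ + 2 * (|cΛ| * Cs) * cC)) * (8 * A + 8 * A ^ 2 + 4 * A * Lc + 12 * A ^ 2 * Lc) * Zl (3 + 1) (min δK κ₁ / (4 * ((3 : ℝ) + 1)))) := by
    positivity
  have hn0 : 0 ≤ (n : ℝ) + 1 := by positivity
  -- MY PAIR PART 1 at the two members' coefficient families, then the last step
  have key := fun (a' b' : Fib 3) =>
    (abs_weight_mul_comb_contactPair_le_three (i := j + 1) (n := n) hLc hr hrl hrt hcE hN1 hCauϑ hκ₁ hC₁ hcC hϑ0 (hFr r hr) hE hκE hlam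
      (abs_bornLamCoeff_succ_le_of_unitDecayK (d := 3) hK hrate cΛ (j + 1)) hrate2 hCc (divV_combBornLam_succ_eq_zero hrt cΛ (j + 1))
      (abs_bornLamCoeff_succ_le_of_unitDecayK (d := 3) hK hrate cΛ j) hrate2 hCc (divV_combBornLam_succ_eq_zero hrt cΛ j)
      hbr' hbr hbrΔ hδK hTb hTΔ κ₂ u₂ x z a' b').trans
    (final_le hBIG hn0 (pow_nonneg (inv_pos.2 hL).le _) hϑp hEX hpow)
  rw [e3]
  simpa only [e1, e2, Pi.sub_apply, Pi.smul_apply, smul_eq_mul, pow_one, Nat.cast_succ, unitS_combFreshAt_lam_succ_eq_SLam tabs hHff hH] using key a b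

/-- NOT IN PRINT; OUR PROOF (`d = 3`, `2 ≤ Lc`).  **THE (III′) BORN-Λ CONTACT PAIR `hPc′` — LITERALLY road-P2 M.104's FOURTH HYPOTHESIS** (with `q = 1`): the centred leg roots
`r = rl = ctrOff (3+1) Lc` (`ctr (3+1) Lc = toSite (ctrOff (3+1) Lc)` by `rfl`), the sym-table record `tabs.H = symHessFFAt (toSite rr) Lc` at any in-block root, every weight base
`|cE| ≤ Lc^4` and every `cΛ`. -/
theorem exists_comb_hPc_ctr (hLc : 2 ≤ Lc) (tabs : SymTables 3 Lc) (hHff : ∀ μ y, IsFF (tabs.H μ y)) {rr : Fin (3 + 1) → ℕ} (hrr : rr ∈ box (3 + 1) Lc)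
    (hH : tabs.H = symHessFFAt (toSite rr) Lc) {cE : ℝ} (hcE : |cE| ≤ (Lc : ℝ) ^ 4) (cΛ : ℝ) :
    ∃ CPc Θc : ℝ, 0 ≤ CPc ∧ 0 ≤ Θc ∧ Θc < 1 ∧ ∀ k i : ℕ, 1 ≤ i → i < k → ∀ κ u,
      SupBound
        (((fun κ' u' => (cE * (Lc : ℝ) ^ (2 * (3 + 1))) ^ (k - i) •
            (push₃ (legChain (fun j => legComp (fun α x κ u => psiKS (ctrOff (3 + 1) Lc) Lc u x (Sum.inl κ) (Sum.inl α)) (respStepBmSeq (d := 3) (ctr (3 + 1) Lc) Lc j)) (i + 1) (k - 1 - i))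
                (legChain (fun j => legComp (fun α x κ u => psiKS (ctrOff (3 + 1) Lc) Lc u x (Sum.inl κ) (Sum.inl α)) (respStepBmSeq (d := 3) (ctr (3 + 1) Lc) Lc j)) (i + 1) (k - 1 - i))
                (legChain (fun j => legComp (fun α x κ u => psiKS (ctrOff (3 + 1) Lc) Lc u x (Sum.inl κ) (Sum.inl α)) (respStepBmSeq (d := 3) (ctr (3 + 1) Lc) Lc j)) (i + 1) (k - 1 - i))
                (unitS (sfStep Lc (i + 1)) (smStep 3 Lc (i + 1)) (combFreshAt tabs 0 cΛ (i + 1))) κ' u'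
              - push₃ (respStep (d := 3) (Lc ^ (i + 1)) (Lc ^ (k + 1))) (respStep (d := 3) (Lc ^ (i + 1)) (Lc ^ (k + 1)))
                (respStep (d := 3) (Lc ^ (i + 1)) (Lc ^ (k + 1)))
                (unitS (sfStep Lc (i + 1)) (smStep 3 Lc (i + 1)) (combFreshAt tabs 0 cΛ (i + 1))) κ' u'))
          - fun κ' u' => (cE * (Lc : ℝ) ^ (2 * (3 + 1))) ^ (k - i) •
            (push₃ (legChain (fun j => legComp (fun α x κ u => psiKS (ctrOff (3 + 1) Lc) Lc u x (Sum.inl κ) (Sum.inl α)) (respStepBmSeq (d := 3) (ctr (3 + 1) Lc) Lc j)) i (k - 1 - i))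
                (legChain (fun j => legComp (fun α x κ u => psiKS (ctrOff (3 + 1) Lc) Lc u x (Sum.inl κ) (Sum.inl α)) (respStepBmSeq (d := 3) (ctr (3 + 1) Lc) Lc j)) i (k - 1 - i))
                (legChain (fun j => legComp (fun α x κ u => psiKS (ctrOff (3 + 1) Lc) Lc u x (Sum.inl κ) (Sum.inl α)) (respStepBmSeq (d := 3) (ctr (3 + 1) Lc) Lc j)) i (k - 1 - i))
                (unitS (sfStep Lc i) (smStep 3 Lc i) (combFreshAt tabs 0 cΛ i)) κ' u'
              - push₃ (respStep (d := 3) (Lc ^ i) (Lc ^ k)) (respStep (d := 3) (Lc ^ i) (Lc ^ k)) (respStep (d := 3) (Lc ^ i) (Lc ^ k))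
                (unitS (sfStep Lc i) (smStep 3 Lc i) (combFreshAt tabs 0 cΛ i)) κ' u')) κ u)
        (CPc * ((((k - i : ℕ) : ℝ)) ^ 1 * Θc ^ k)) := by
  obtain ⟨CPc, Θc, hC, hΘ0, hΘ1, h⟩ := exists_comb_hPc_three (Lc := Lc) hLc hcE cΛ
  have hc : ctrOff (3 + 1) Lc ∈ box (3 + 1) Lc := ctrOff_mem_box (by omega)
  exact ⟨CPc, Θc, hC, hΘ0, hΘ1, fun k i hi hik κ u => h tabs hHff rr hrr hH _ hc _ hc k i hi hik κ u⟩

/-- NOT IN PRINT; OUR PROOF (`d = 3`, `2 ≤ Lc`).  **THE SAME AT ANY LOG POWER `q ≥ 1`** (M.104's `hPc` shares its implicit `q` with the born-V pair `hPcV`; `(k−i)^1 ≤ (k−i)^q` on `i < k`,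
`SupBound` is monotone in its constant). -/
theorem exists_comb_hPc_ctr_pow (hLc : 2 ≤ Lc) (tabs : SymTables 3 Lc) (hHff : ∀ μ y, IsFF (tabs.H μ y)) {rr : Fin (3 + 1) → ℕ} (hrr : rr ∈ box (3 + 1) Lc)
    (hH : tabs.H = symHessFFAt (toSite rr) Lc) {cE : ℝ} (hcE : |cE| ≤ (Lc : ℝ) ^ 4) (cΛ : ℝ) {q : ℕ} (hq : 1 ≤ q) :
    ∃ CPc Θc : ℝ, 0 ≤ CPc ∧ 0 ≤ Θc ∧ Θc < 1 ∧ ∀ k i : ℕ, 1 ≤ i → i < k → ∀ κ u,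
      SupBound
        (((fun κ' u' => (cE * (Lc : ℝ) ^ (2 * (3 + 1))) ^ (k - i) •
            (push₃ (legChain (fun j => legComp (fun α x κ u => psiKS (ctrOff (3 + 1) Lc) Lc u x (Sum.inl κ) (Sum.inl α)) (respStepBmSeq (d := 3) (ctr (3 + 1) Lc) Lc j)) (i + 1) (k - 1 - i))
                (legChain (fun j => legComp (fun α x κ u => psiKS (ctrOff (3 + 1) Lc) Lc u x (Sum.inl κ) (Sum.inl α)) (respStepBmSeq (d := 3) (ctr (3 + 1) Lc) Lc j)) (i + 1) (k - 1 - i))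
                (legChain (fun j => legComp (fun α x κ u => psiKS (ctrOff (3 + 1) Lc) Lc u x (Sum.inl κ) (Sum.inl α)) (respStepBmSeq (d := 3) (ctr (3 + 1) Lc) Lc j)) (i + 1) (k - 1 - i))
                (unitS (sfStep Lc (i + 1)) (smStep 3 Lc (i + 1)) (combFreshAt tabs 0 cΛ (i + 1))) κ' u'
              - push₃ (respStep (d := 3) (Lc ^ (i + 1)) (Lc ^ (k + 1))) (respStep (d := 3) (Lc ^ (i + 1)) (Lc ^ (k + 1)))
                (respStep (d := 3) (Lc ^ (i + 1)) (Lc ^ (k + 1)))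
                (unitS (sfStep Lc (i + 1)) (smStep 3 Lc (i + 1)) (combFreshAt tabs 0 cΛ (i + 1))) κ' u'))
          - fun κ' u' => (cE * (Lc : ℝ) ^ (2 * (3 + 1))) ^ (k - i) •
            (push₃ (legChain (fun j => legComp (fun α x κ u => psiKS (ctrOff (3 + 1) Lc) Lc u x (Sum.inl κ) (Sum.inl α)) (respStepBmSeq (d := 3) (ctr (3 + 1) Lc) Lc j)) i (k - 1 - i))
                (legChain (fun j => legComp (fun α x κ u => psiKS (ctrOff (3 + 1) Lc) Lc u x (Sum.inl κ) (Sum.inl α)) (respStepBmSeq (d := 3) (ctr (3 + 1) Lc) Lc j)) i (k - 1 - i))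
                (legChain (fun j => legComp (fun α x κ u => psiKS (ctrOff (3 + 1) Lc) Lc u x (Sum.inl κ) (Sum.inl α)) (respStepBmSeq (d := 3) (ctr (3 + 1) Lc) Lc j)) i (k - 1 - i))
                (unitS (sfStep Lc i) (smStep 3 Lc i) (combFreshAt tabs 0 cΛ i)) κ' u'
              - push₃ (respStep (d := 3) (Lc ^ i) (Lc ^ k)) (respStep (d := 3) (Lc ^ i) (Lc ^ k)) (respStep (d := 3) (Lc ^ i) (Lc ^ k))
                (unitS (sfStep Lc i) (smStep 3 Lc i) (combFreshAt tabs 0 cΛ i)) κ' u')) κ u)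
        (CPc * ((((k - i : ℕ) : ℝ)) ^ q * Θc ^ k)) := by
  obtain ⟨CPc, Θc, hC, hΘ0, hΘ1, h⟩ := exists_comb_hPc_ctr (Lc := Lc) hLc tabs hHff hrr hH hcE cΛ
  refine ⟨CPc, Θc, hC, hΘ0, hΘ1, fun k i hi hik κ u x z a b => ((h k i hi hik κ u) x z a b).trans ?_⟩
  have hm : (1 : ℝ) ≤ ((k - i : ℕ) : ℝ) := by exact_mod_cast (show 1 ≤ k - i by omega)
  exact mul_le_mul_of_nonneg_left (mul_le_mul_of_nonneg_right (pow_le_pow_right₀ hm hq) (pow_nonneg hΘ0 _)) hC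

end Summit.QuantumFields.BalabanUV.Beta.GAN24.CombBornLambdaContactDrift

end
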